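import Mathlib
import Literature.NumberTheory.Transcendental.ExpPointsBranchAtInfinity
import Literature.NumberTheory.Transcendental.ExpPointsDegenerateSections

/-!
# Coset branch cover at infinity — crux stmt-Schanuel-0969 `RigidCore.MinimalCounterexampleInAcl`

Line `kernel-arithmetic-selection`, stub `stub_cosetBranchCover` (gen 14), `--supports
stmt-Schanuel-0969`.  This is the COVERING version, on a kernel coset `x₀ ∈ c + 2πiℤ`, of the tree
theorem `Literature.NumberTheory.Transcendental.exists_branch_through_hits`.

Let `W ⊆ ℂ² × ℂ²` be Zariski closed with `zariskiDim ℂ W < 2` and let `c ∈ ℂ`.  Then there are a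
ramification `e ≥ 1`, radii `R, r > 0`, a FINITE set `B` of branch data `b = (Φ₁, Φ₂, Φ₃, N)`
(`Φⱼ` analytic on `|t| < r`, the germ `𝔟_b(t) = ((t⁻ᵉ, Φ₁(t) t⁻ᴺ), (Φ₂(t) t⁻ᴺ, Φ₃(t) t⁻ᴺ))`
contained in `W` for `0 < |t| < r`) and a FINITE exceptional set `X ⊆ ℂ²`, such that every
independent exponential point `x` of `W` (`x ∈ indepExpPoints W`) on the coset `x₀ ∈ c + 2πiℤ`
with `R < |x₀|` and `x ∉ X` is the point `𝔟_b(ρ)` of some branch `b ∈ B` at the PRINCIPAL root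
`ρ = x₀ ^ (-1/e)` (so `ρ ^ e = x₀⁻¹`, `0 < |ρ| < r`).

Proof (that of `exists_branch_through_hits`, class by class).  The coordinate pairs `(x₀, x₁)`,
`(x₀, y₀)`, `(x₀, y₁)` satisfy non-trivial polynomial relations on `W`
(`exists_relation_pair_of_zariskiDim_lt_two`); near `x₀ = ∞` their solutions lie on finitely many
Puiseux branches (`exists_branch_atlas`), valid at every root `t` of `t ^ {eᵢ} = x₀⁻¹`, in
particular at the powers `ρ ^ {mᵢ}` of the principal `e`-th root, `e = e₁ e₂ e₃`.  This sorts
the large points into finitely many classes `U_b`; on a class, `x₁` is a function of `x₀`, so the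
coset points of a class with `|x₀| ≤ R'` are finitely many (finitely many `k`).  Hence a class
carrying infinitely many coset points carries coset points with `|x₀|` arbitrarily large, i.e.
with parameter `ρ` arbitrarily small, and — the branch point being a curve germ with meromorphic
coordinates on which every defining polynomial of `W` then vanishes frequently near `t = 0` —
its rescaled branch lies in `W` on a punctured disc (`MeromorphicCurveGerms`).  The finitely
many coset points of the remaining (finite) classes form the exceptional set `X`. [folklore]
-/

noncomputable section

set_option linter.dupNamespace false

open Complex Filter Topology Set Metric MvPolynomial

namespace Summit.Schanuel.Schanuel.Cruxes.MinimalCounterexampleInAcl.KernelArithmeticSelection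

open Literature.NumberTheory.Transcendental
open Literature.Analysis.Complex.PuiseuxInfinity (exists_branch_atlas)
open Literature.Analysis.Complex.MeromorphicGerm (analyticAt_pow_succ_mul_div_pow
  analyticAt_pow_succ_mul_inv_pow exists_analyticAt_pow_mul_aeval exists_radius_eq_zero
  frequently_nhdsNE_of_forall_exists ne_zero_and_norm_lt_of_pow_eq_inv)

/-- The branch point `((t⁻ᵉ, Φ₁ t / tᴺ), (Φ₂ t / tᴺ, Φ₃ t / tᴺ)) ∈ ℂ² × ℂ²` (local notation). -/
local notation3 "𝔟[" e ", " N ", " Φ₁ ", " Φ₂ ", " Φ₃ ", " t "]" =>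
  (Sum.elim ![((t : ℂ) ^ (e : ℕ))⁻¹, (Φ₁ : ℂ → ℂ) t / t ^ (N : ℕ)]
    ![(Φ₂ : ℂ → ℂ) t / t ^ (N : ℕ), (Φ₃ : ℂ → ℂ) t / t ^ (N : ℕ)] : Fin 2 ⊕ Fin 2 → ℂ)

/-! ## Preliminaries -/

/-- The principal `e`-th root `z ^ (-1/e)` of `z⁻¹` satisfies `(z ^ (-1/e)) ^ e = z⁻¹` (also at
`z = 0`, where both sides vanish). [folklore] -/
theorem cosetBranchCover_cpow_neg_inv_pow (z : ℂ) {e : ℕ} (he : e ≠ 0) :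
    (z ^ (-((e : ℂ)⁻¹))) ^ e = z⁻¹ := by
  rw [← Complex.cpow_nat_mul, mul_neg, mul_inv_cancel₀ (Nat.cast_ne_zero.2 he),
    Complex.cpow_neg_one]

/-- A bounded piece of a coset `c + 2πiℤ` is finite. [folklore] -/
theorem cosetBranchCover_finite_coset_norm_le (c : ℂ) (M : ℝ) :
    Set.Finite {u : ℂ | (∃ k : ℤ, u = c + 2 * ↑Real.pi * Complex.I * (k : ℂ)) ∧ ‖u‖ ≤ M} := by
  have hZ : (Metric.closedBall (0 : ℤ) ((M + ‖c‖) / (2 * Real.pi))).Finite := by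
    rw [Int.closedBall_eq_Icc]
    exact Set.finite_Icc _ _
  refine (hZ.image fun k : ℤ => c + 2 * ↑Real.pi * Complex.I * (k : ℂ)).subset ?_
  rintro u ⟨⟨k, rfl⟩, hu⟩
  refine ⟨k, ?_, rfl⟩
  have h2π : (0 : ℝ) < 2 * Real.pi := by positivity
  rw [Metric.mem_closedBall, dist_zero_right, le_div_iff₀ h2π]
  have hnorm : ‖(2 * ↑Real.pi * Complex.I * (k : ℂ) : ℂ)‖ = ‖k‖ * (2 * Real.pi) := by
    rw [norm_mul, norm_mul, norm_mul, Complex.norm_I, mul_one, Complex.norm_real,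
      Real.norm_of_nonneg Real.pi_pos.le, Complex.norm_intCast, Int.norm_eq_abs,
      Complex.norm_two]
    ring
  calc ‖k‖ * (2 * Real.pi) = ‖(c + 2 * ↑Real.pi * Complex.I * (k : ℂ)) - c‖ := by
        rw [add_sub_cancel_left, hnorm]
    _ ≤ ‖c + 2 * ↑Real.pi * Complex.I * (k : ℂ)‖ + ‖c‖ := norm_sub_le _ _
    _ ≤ M + ‖c‖ := by gcongr

/-- **A curve germ at infinity hit frequently by `W` lies in `W`.**  If the branch point
`𝔟(t) = ((t⁻ᵉ, Φ₁ t / tᴺ), (Φ₂ t / tᴺ, Φ₃ t / tᴺ))` (`Φⱼ` analytic at `0`) belongs to the Zariski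
closed set `W` for parameters `t ≠ 0` arbitrarily close to `0`, then it belongs to `W` on a whole
punctured disc: every generator of the (finitely generated) ideal of `W` is, along the germ, a
meromorphic function vanishing frequently near `0` (`exists_analyticAt_pow_mul_aeval`,
`exists_radius_eq_zero`).  Extracted from the proof of `exists_branch_through_hits`. [folklore] -/
theorem cosetBranchCover_branch_mem_of_forall_exists {W : Set (Fin 2 ⊕ Fin 2 → ℂ)}
    (hcl : IsZariskiClosed ℂ W) {e N : ℕ} {Φ₁ Φ₂ Φ₃ : ℂ → ℂ} (ha₁ : AnalyticAt ℂ Φ₁ 0)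
    (ha₂ : AnalyticAt ℂ Φ₂ 0) (ha₃ : AnalyticAt ℂ Φ₃ 0)
    (hfr : ∀ ε : ℝ, 0 < ε → ∃ t : ℂ, 0 < ‖t‖ ∧ ‖t‖ < ε ∧ 𝔟[e, N, Φ₁, Φ₂, Φ₃, t] ∈ W) :
    ∃ δ > 0, ∀ t : ℂ, 0 < ‖t‖ → ‖t‖ < δ → 𝔟[e, N, Φ₁, Φ₂, Φ₃, t] ∈ W := by
  classical
  obtain ⟨J, hJ⟩ := hcl
  obtain ⟨G, hG⟩ := (isNoetherian_def.1 (inferInstance : IsNoetherian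
    (MvPolynomial (Fin 2 ⊕ Fin 2) ℂ) (MvPolynomial (Fin 2 ⊕ Fin 2) ℂ))) J
  have hcoord : ∀ k : Fin 2 ⊕ Fin 2, ∃ K : ℕ,
      AnalyticAt ℂ (fun t : ℂ => t ^ K * 𝔟[e, N, Φ₁, Φ₂, Φ₃, t] k) 0 := by
    intro k
    rcases k with k | k <;> fin_cases k
    · exact ⟨e + 1, analyticAt_pow_succ_mul_inv_pow e⟩
    · exact ⟨N + 1, analyticAt_pow_succ_mul_div_pow ha₁ N⟩
    · exact ⟨N + 1, analyticAt_pow_succ_mul_div_pow ha₂ N⟩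
    · exact ⟨N + 1, analyticAt_pow_succ_mul_div_pow ha₃ N⟩
  have hrad : ∀ p ∈ G, ∃ δ > 0, ∀ t : ℂ, 0 < ‖t‖ → ‖t‖ < δ →
      MvPolynomial.aeval 𝔟[e, N, Φ₁, Φ₂, Φ₃, t] p = 0 := by
    intro p hp
    obtain ⟨K, hK⟩ :=
      exists_analyticAt_pow_mul_aeval (fun t : ℂ => 𝔟[e, N, Φ₁, Φ₂, Φ₃, t]) hcoord p
    refine exists_radius_eq_zero hK (frequently_nhdsNE_of_forall_exists fun ε hε => ?_)
    obtain ⟨t, ht0, htε, htW⟩ := hfr ε hε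
    refine ⟨t, ht0, htε, ?_⟩
    rw [hJ, MvPolynomial.mem_zeroLocus_iff] at htW
    exact htW p (hG ▸ Ideal.subset_span hp)
  choose! δp hδp hzero using hrad
  set δ₀ : ℝ := if hG0 : G.Nonempty then G.inf' hG0 δp else 1 with hδ₀
  have hδ₀pos : 0 < δ₀ := by
    rw [hδ₀]; split_ifs with hG0
    · exact (Finset.lt_inf'_iff hG0).2 fun p hp => hδp p hp
    · exact one_pos
  have hδ₀le : ∀ p ∈ G, δ₀ ≤ δp p := fun p hp => by
    rw [hδ₀, dif_pos ⟨p, hp⟩]; exact Finset.inf'_le _ hp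
  refine ⟨δ₀, hδ₀pos, fun t ht0 htr => ?_⟩
  rw [hJ, ← hG, MvPolynomial.zeroLocus_span]
  intro p hp
  exact hzero p hp t ht0 (htr.trans_le (hδ₀le p hp))

/-! ## The cover -/

/-- **Stub `stub_cosetBranchCover` — COSET BRANCH COVER AT INFINITY** (covering version of
`Literature.NumberTheory.Transcendental.exists_branch_through_hits` on a kernel coset; see the
module docstring).  For `W ⊆ ℂ² × ℂ²` Zariski closed of `zariskiDim < 2` and `c ∈ ℂ`: finitely
many analytic branches at `x₀ = ∞` contained in `W`, parametrised by the principal root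
`ρ = x₀ ^ (-1/e)`, cover all but finitely many independent exponential points of `W` on the coset
`x₀ ∈ c + 2πiℤ` beyond a radius `R`. [folklore] -/
theorem stub_cosetBranchCover : ∀ (W : Set (Fin 2 ⊕ Fin 2 → ℂ)), Literature.NumberTheory.Transcendental.IsZariskiClosed ℂ W → Literature.NumberTheory.Transcendental.zariskiDim ℂ W < 2 → ∀ (c : ℂ), ∃ (e : ℕ) (R r : ℝ) (B : Finset ((ℂ → ℂ) × (ℂ → ℂ) × (ℂ → ℂ) × ℕ)) (X : Set (Fin 2 → ℂ)), 0 < e ∧ 0 < r ∧ X.Finite ∧ (∀ b ∈ B, (∀ t : ℂ, ‖t‖ < r → AnalyticAt ℂ b.1 t ∧ AnalyticAt ℂ b.2.1 t ∧ AnalyticAt ℂ b.2.2.1 t) ∧ ∀ t : ℂ, 0 < ‖t‖ → ‖t‖ < r → (Sum.elim ![(t ^ e)⁻¹, b.1 t / t ^ b.2.2.2] ![b.2.1 t / t ^ b.2.2.2, b.2.2.1 t / t ^ b.2.2.2] : Fin 2 ⊕ Fin 2 → ℂ) ∈ W) ∧ ∀ x ∈ Literature.NumberTheory.Transcendental.indepExpPoints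 W, (∃ k : ℤ, x 0 = c + 2 * ↑Real.pi * Complex.I * (k : ℂ)) → R < ‖x 0‖ → x ∉ X → ∃ b ∈ B, 0 < ‖(x 0) ^ (-((e : ℂ)⁻¹))‖ ∧ ‖(x 0) ^ (-((e : ℂ)⁻¹))‖ < r ∧ Sum.elim x (Complex.exp ∘ x) = (Sum.elim ![(((x 0) ^ (-((e : ℂ)⁻¹))) ^ e)⁻¹, b.1 ((x 0) ^ (-((e : ℂ)⁻¹))) / ((x 0) ^ (-((e : ℂ)⁻¹))) ^ b.2.2.2] ![b.2.1 ((x 0) ^ (-((e : ℂ)⁻¹))) / ((x 0) ^ (-((e : ℂ)⁻¹))) ^ b.2.2.2, b.2.2.1 ((x 0) ^ (-((e : ℂ)⁻¹))) / ((x 0) ^ (-((e : ℂ)⁻¹))) ^ b.2.2.2] : Fin 2 ⊕ Fin 2 → ℂ) := by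
  intro W hcl hdim c
  classical
  -- ### relations and atlases
  obtain ⟨P₁, hP₁, hrel₁⟩ :=
    exists_relation_pair_of_zariskiDim_lt_two W hdim (Sum.inl 0) (Sum.inl 1)
  obtain ⟨P₂, hP₂, hrel₂⟩ :=
    exists_relation_pair_of_zariskiDim_lt_two W hdim (Sum.inl 0) (Sum.inr 0)
  obtain ⟨P₃, hP₃, hrel₃⟩ :=
    exists_relation_pair_of_zariskiDim_lt_two W hdim (Sum.inl 0) (Sum.inr 1)
  obtain ⟨e₁, he₁, R₁, r₁, hr₁, hr₁1, B₁, hB₁, hat₁⟩ := exists_branch_atlas P₁ hP₁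
  obtain ⟨e₂, he₂, R₂, r₂, hr₂, hr₂1, B₂, hB₂, hat₂⟩ := exists_branch_atlas P₂ hP₂
  obtain ⟨e₃, he₃, R₃, r₃, hr₃, hr₃1, B₃, hB₃, hat₃⟩ := exists_branch_atlas P₃ hP₃
  -- ### the common ramification and the principal master root
  obtain ⟨m₁, hm₁⟩ : ∃ m : ℕ, m = e₂ * e₃ := ⟨_, rfl⟩
  obtain ⟨m₂, hm₂⟩ : ∃ m : ℕ, m = e₁ * e₃ := ⟨_, rfl⟩
  obtain ⟨m₃, hm₃⟩ : ∃ m : ℕ, m = e₁ * e₂ := ⟨_, rfl⟩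
  obtain ⟨e, he_def⟩ : ∃ e : ℕ, e = e₁ * e₂ * e₃ := ⟨_, rfl⟩
  have he : 0 < e := he_def ▸ Nat.mul_pos (Nat.mul_pos he₁ he₂) he₃
  have hm₁e : m₁ * e₁ = e := by rw [hm₁, he_def]; ring
  have hm₂e : m₂ * e₂ = e := by rw [hm₂, he_def]; ring
  have hm₃e : m₃ * e₃ = e := by rw [hm₃, he_def]
  have hm₁pos : 0 < m₁ := hm₁ ▸ Nat.mul_pos he₂ he₃
  have hm₂pos : 0 < m₂ := hm₂ ▸ Nat.mul_pos he₁ he₃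
  have hm₃pos : 0 < m₃ := hm₃ ▸ Nat.mul_pos he₁ he₂
  -- the principal `e`-th root `ρt x` of `(x 0)⁻¹`
  set ρt : (Fin 2 → ℂ) → ℂ := fun x => (x 0) ^ (-((e : ℂ)⁻¹)) with hρt_def
  have hρt : ∀ x, ρt x ^ e = (x 0)⁻¹ := fun x =>
    cosetBranchCover_cpow_neg_inv_pow (x 0) he.ne'
  have hρt₁ : ∀ x, (ρt x ^ m₁) ^ e₁ = (x 0)⁻¹ := fun x => by rw [← pow_mul, hm₁e, hρt]
  have hρt₂ : ∀ x, (ρt x ^ m₂) ^ e₂ = (x 0)⁻¹ := fun x => by rw [← pow_mul, hm₂e, hρt]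
  have hρt₃ : ∀ x, (ρt x ^ m₃) ^ e₃ = (x 0)⁻¹ := fun x => by rw [← pow_mul, hm₃e, hρt]
  -- ### values at the independent exponential points
  have hvals : ∀ x ∈ indepExpPoints W, MvPolynomial.eval ![x 0, x 1] P₁ = 0 ∧
      MvPolynomial.eval ![x 0, Complex.exp (x 0)] P₂ = 0 ∧
      MvPolynomial.eval ![x 0, Complex.exp (x 1)] P₃ = 0 :=
    fun x hx => ⟨hrel₁ (Sum.elim x (Complex.exp ∘ x)) hx.2,
      hrel₂ (Sum.elim x (Complex.exp ∘ x)) hx.2, hrel₃ (Sum.elim x (Complex.exp ∘ x)) hx.2⟩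
  -- ### the classes of the large points
  set R₀ : ℝ := max R₁ (max R₂ R₃) with hR₀
  set U : ((ℂ → ℂ) × ℕ) × (((ℂ → ℂ) × ℕ) × ((ℂ → ℂ) × ℕ)) → Set (Fin 2 → ℂ) := fun b =>
    {x | x 1 = b.1.1 (ρt x ^ m₁) / (ρt x ^ m₁) ^ b.1.2 ∧
      Complex.exp (x 0) = b.2.1.1 (ρt x ^ m₂) / (ρt x ^ m₂) ^ b.2.1.2 ∧
      Complex.exp (x 1) = b.2.2.1 (ρt x ^ m₃) / (ρt x ^ m₃) ^ b.2.2.2} with hU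
  have hcov : ∀ x ∈ indepExpPoints W, R₀ < ‖x 0‖ → ∃ b ∈ B₁ ×ˢ (B₂ ×ˢ B₃), x ∈ U b := by
    intro x hx hRx
    obtain ⟨h1, h2, h3⟩ := hvals x hx
    have hR₁x : R₁ < ‖x 0‖ := lt_of_le_of_lt (le_max_left _ _) hRx
    have hR₂x : R₂ < ‖x 0‖ := lt_of_le_of_lt ((le_max_left _ _).trans (le_max_right _ _)) hRx
    have hR₃x : R₃ < ‖x 0‖ :=
      lt_of_le_of_lt ((le_max_right _ _).trans (le_max_right _ _)) hRx
    obtain ⟨-, -, b₁, hb₁, hv₁⟩ := hat₁ (x 0) (x 1) hR₁x h1 (ρt x ^ m₁) (hρt₁ x)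
    obtain ⟨-, -, b₂, hb₂, hv₂⟩ := hat₂ (x 0) (Complex.exp (x 0)) hR₂x h2 (ρt x ^ m₂) (hρt₂ x)
    obtain ⟨-, -, b₃, hb₃, hv₃⟩ := hat₃ (x 0) (Complex.exp (x 1)) hR₃x h3 (ρt x ^ m₃) (hρt₃ x)
    exact ⟨(b₁, (b₂, b₃)), Finset.mk_mem_product hb₁ (Finset.mk_mem_product hb₂ hb₃),
      hv₁, hv₂, hv₃⟩
  -- on a class, a point is determined by its first coordinate
  have hinj : ∀ b, Set.InjOn (fun x : Fin 2 → ℂ => x 0) (U b) := by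
    intro b x hx x' hx' h0
    have h0' : x 0 = x' 0 := h0
    have hρ : ρt x = ρt x' := by
      show (x 0) ^ (-((e : ℂ)⁻¹)) = (x' 0) ^ (-((e : ℂ)⁻¹))
      rw [h0']
    have h1 : x 1 = x' 1 := by rw [hx.1, hx'.1, hρ]
    funext k
    fin_cases k
    · exact h0'
    · exact h1
  -- ### the coset points of a class
  set Tc : ((ℂ → ℂ) × ℕ) × (((ℂ → ℂ) × ℕ) × ((ℂ → ℂ) × ℕ)) → Set (Fin 2 → ℂ) := fun b =>
    {x | x ∈ indepExpPoints W ∧ (∃ k : ℤ, x 0 = c + 2 * ↑Real.pi * Complex.I * (k : ℂ)) ∧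
      R₀ < ‖x 0‖ ∧ x ∈ U b} with hTc
  -- an infinite class of coset points is unbounded in the first coordinate (strong form)
  have hunb : ∀ b, (Tc b).Infinite → ∀ R' : ℝ, Set.Infinite {x | x ∈ Tc b ∧ R' < ‖x 0‖} := by
    intro b hb R' hcon
    have hfin : Set.Finite {x | x ∈ Tc b ∧ ‖x 0‖ ≤ R'} := by
      refine Set.Finite.of_finite_image (f := fun x : Fin 2 → ℂ => x 0)
        ((cosetBranchCover_finite_coset_norm_le c R').subset ?_)
        ((hinj b).mono fun x hx => hx.1.2.2.2)
      rintro _ ⟨x, ⟨hxT, hle⟩, rfl⟩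
      exact ⟨hxT.2.1, hle⟩
    refine hb ((hcon.union hfin).subset fun x hx => ?_)
    rcases lt_or_ge R' ‖x 0‖ with h | h
    · exact Or.inl ⟨hx, h⟩
    · exact Or.inr ⟨hx, h⟩
  -- ### the infinite classes and the exceptional set
  set Bi : Finset (((ℂ → ℂ) × ℕ) × (((ℂ → ℂ) × ℕ) × ((ℂ → ℂ) × ℕ))) :=
    (B₁ ×ˢ (B₂ ×ˢ B₃)).filter (fun b => (Tc b).Infinite) with hBi
  set Bf : Finset (((ℂ → ℂ) × ℕ) × (((ℂ → ℂ) × ℕ) × ((ℂ → ℂ) × ℕ))) :=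
    (B₁ ×ˢ (B₂ ×ˢ B₃)).filter (fun b => (Tc b).Finite) with hBf
  set X : Set (Fin 2 → ℂ) := ⋃ b ∈ (↑Bf : Set _), Tc b with hX
  have hXfin : X.Finite :=
    Set.Finite.biUnion Bf.finite_toSet fun b hb => (Finset.mem_filter.1 (Finset.mem_coe.1 hb)).2
  -- ### the branches
  set Nf : ((ℂ → ℂ) × ℕ) × (((ℂ → ℂ) × ℕ) × ((ℂ → ℂ) × ℕ)) → ℕ := fun b =>
    m₁ * b.1.2 + m₂ * b.2.1.2 + m₃ * b.2.2.2 with hNf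
  have hN₁ : ∀ b, m₁ * b.1.2 ≤ Nf b := fun b => by
    show m₁ * b.1.2 ≤ m₁ * b.1.2 + m₂ * b.2.1.2 + m₃ * b.2.2.2
    omega
  have hN₂ : ∀ b, m₂ * b.2.1.2 ≤ Nf b := fun b => by
    show m₂ * b.2.1.2 ≤ m₁ * b.1.2 + m₂ * b.2.1.2 + m₃ * b.2.2.2
    omega
  have hN₃ : ∀ b, m₃ * b.2.2.2 ≤ Nf b := fun b => by
    show m₃ * b.2.2.2 ≤ m₁ * b.1.2 + m₂ * b.2.1.2 + m₃ * b.2.2.2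
    omega
  set Φ₁f : ((ℂ → ℂ) × ℕ) × (((ℂ → ℂ) × ℕ) × ((ℂ → ℂ) × ℕ)) → ℂ → ℂ := fun b t =>
    b.1.1 (t ^ m₁) * t ^ (Nf b - m₁ * b.1.2) with hΦ₁f
  set Φ₂f : ((ℂ → ℂ) × ℕ) × (((ℂ → ℂ) × ℕ) × ((ℂ → ℂ) × ℕ)) → ℂ → ℂ := fun b t =>
    b.2.1.1 (t ^ m₂) * t ^ (Nf b - m₂ * b.2.1.2) with hΦ₂f
  set Φ₃f : ((ℂ → ℂ) × ℕ) × (((ℂ → ℂ) × ℕ) × ((ℂ → ℂ) × ℕ)) → ℂ → ℂ := fun b t =>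
    b.2.2.1 (t ^ m₃) * t ^ (Nf b - m₃ * b.2.2.2) with hΦ₃f
  set r₀ : ℝ := min 1 (min r₁ (min r₂ r₃)) with hr₀
  have hr₀pos : 0 < r₀ := lt_min one_pos (lt_min hr₁ (lt_min hr₂ hr₃))
  have hr₀1 : r₀ ≤ 1 := min_le_left _ _
  have hr₀₁ : r₀ ≤ r₁ := (min_le_right _ _).trans (min_le_left _ _)
  have hr₀₂ : r₀ ≤ r₂ := (min_le_right _ _).trans ((min_le_right _ _).trans (min_le_left _ _))
  have hr₀₃ : r₀ ≤ r₃ := (min_le_right _ _).trans ((min_le_right _ _).trans (min_le_right _ _))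
  have hanΦ : ∀ b ∈ B₁ ×ˢ (B₂ ×ˢ B₃), ∀ t : ℂ, ‖t‖ < r₀ →
      AnalyticAt ℂ (Φ₁f b) t ∧ AnalyticAt ℂ (Φ₂f b) t ∧ AnalyticAt ℂ (Φ₃f b) t := by
    intro b hb t ht
    simp only [Finset.mem_product] at hb
    obtain ⟨hy₁, hy₂, hy₃⟩ := hb
    exact ⟨analyticAt_rescale (hB₁ _ hy₁) hr₀1 hr₀₁ hm₁pos _ ht,
      analyticAt_rescale (hB₂ _ hy₂) hr₀1 hr₀₂ hm₂pos _ ht,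
      analyticAt_rescale (hB₃ _ hy₃) hr₀1 hr₀₃ hm₃pos _ ht⟩
  -- the points of a class lie on its branch, at the principal root
  have hpt : ∀ b, ∀ x ∈ U b, ρt x ≠ 0 →
      Sum.elim x (Complex.exp ∘ x) = 𝔟[e, Nf b, Φ₁f b, Φ₂f b, Φ₃f b, ρt x] := by
    rintro b x ⟨hx1, hx2, hx3⟩ ht0
    funext k
    rcases k with k | k <;> fin_cases k
    · simp only [Sum.elim_inl, Fin.zero_eta, Fin.isValue, Matrix.cons_val_zero]
      rw [hρt, inv_inv]
    · simp only [Sum.elim_inl, Fin.mk_one, Fin.isValue, Matrix.cons_val_one, Matrix.cons_val_zero]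
      rw [hx1, div_pow_eq_rescale ht0 (hN₁ b)]
    · simp only [Sum.elim_inr, Function.comp_apply, Fin.zero_eta, Fin.isValue,
        Matrix.cons_val_zero]
      rw [hx2, div_pow_eq_rescale ht0 (hN₂ b)]
    · simp only [Sum.elim_inr, Function.comp_apply, Fin.mk_one, Fin.isValue, Matrix.cons_val_one,
        Matrix.cons_val_zero]
      rw [hx3, div_pow_eq_rescale ht0 (hN₃ b)]
  -- ### the branch of an infinite class lies in `W`
  have hW : ∀ b ∈ Bi, ∃ δ > 0, ∀ t : ℂ, 0 < ‖t‖ → ‖t‖ < δ →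
      𝔟[e, Nf b, Φ₁f b, Φ₂f b, Φ₃f b, t] ∈ W := by
    intro b hb
    obtain ⟨hbS, hinfb⟩ := Finset.mem_filter.1 hb
    have h0 : ‖(0 : ℂ)‖ < r₀ := by rw [norm_zero]; exact hr₀pos
    obtain ⟨ha₁, ha₂, ha₃⟩ := hanΦ b hbS 0 h0
    refine cosetBranchCover_branch_mem_of_forall_exists hcl ha₁ ha₂ ha₃ fun ε hε => ?_
    obtain ⟨x, hxT, hxε⟩ := (hunb b hinfb (ε⁻¹ ^ e)).nonempty
    obtain ⟨hx0, hlt⟩ := ne_zero_and_norm_lt_of_pow_eq_inv he hε (hρt x) hxε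
    refine ⟨ρt x, norm_pos_iff.2 hx0, hlt, ?_⟩
    rw [← hpt b x hxT.2.2.2 hx0]
    exact hxT.1.2
  choose! δ hδpos hδW using hW
  set δ₀ : ℝ := if hBi0 : Bi.Nonempty then Bi.inf' hBi0 δ else 1 with hδ₀
  have hδ₀pos : 0 < δ₀ := by
    rw [hδ₀]; split_ifs with hBi0
    · exact (Finset.lt_inf'_iff hBi0).2 fun b hb => hδpos b hb
    · exact one_pos
  have hδ₀le : ∀ b ∈ Bi, δ₀ ≤ δ b := fun b hb => by
    rw [hδ₀, dif_pos ⟨b, hb⟩]; exact Finset.inf'_le _ hb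
  -- ### the radii and the cover
  set r : ℝ := min r₀ δ₀ with hr
  have hrpos : 0 < r := lt_min hr₀pos hδ₀pos
  set R : ℝ := max R₀ (r⁻¹ ^ e) with hR
  refine ⟨e, R, r, Bi.image (fun b => (Φ₁f b, Φ₂f b, Φ₃f b, Nf b)), X, he, hrpos, hXfin,
    ?_, ?_⟩
  · -- the branches are analytic on `‖t‖ < r` and lie in `W` on `0 < ‖t‖ < r`
    intro b' hb'
    obtain ⟨b, hb, rfl⟩ := Finset.mem_image.1 hb'
    have hbS : b ∈ B₁ ×ˢ (B₂ ×ˢ B₃) := (Finset.mem_filter.1 hb).1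
    exact ⟨fun t ht => hanΦ b hbS t (ht.trans_le (min_le_left _ _)), fun t ht0 htr =>
      hδW b hb t ht0 (htr.trans_le ((min_le_right _ _).trans (hδ₀le b hb)))⟩
  · -- every large coset point outside `X` lies on a branch of an infinite class
    intro x hx hk hRx hxX
    have hR₀x : R₀ < ‖x 0‖ := lt_of_le_of_lt (le_max_left _ _) hRx
    obtain ⟨b, hbS, hxU⟩ := hcov x hx hR₀x
    have hxT : x ∈ Tc b := ⟨hx, hk, hR₀x, hxU⟩
    have hb : b ∈ Bi := by
      refine Finset.mem_filter.2 ⟨hbS, fun hfin => hxX ?_⟩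
      exact Set.mem_biUnion (Finset.mem_coe.2 (Finset.mem_filter.2 ⟨hbS, hfin⟩)) hxT
    obtain ⟨h0, hlt⟩ := ne_zero_and_norm_lt_of_pow_eq_inv he hrpos (hρt x)
      (lt_of_le_of_lt (le_max_right _ _) hRx)
    exact ⟨_, Finset.mem_image_of_mem _ hb, norm_pos_iff.2 h0, hlt, hpt b x hxU h0⟩

end Summit.Schanuel.Schanuel.Cruxes.MinimalCounterexampleInAcl.KernelArithmeticSelection

end
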